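import Mathlib
import Summits.Ventures.HodgeRepro2.T5GenericTriples

/-!
# T5RationalDensity — a non-zero polynomial does not vanish on the points of an infinite
subset (Zariski density of `ℚ^N` and `(ℚ^×)^N` in `ℂ^N`)

Two places of the cell's record use the «Zariski density of rational points» as a standard
fact without a locator: T4-B3 §B3(d.3) («Zariski density of the ℚ-points of
`Res_{k′/ℚ} G_m`», in the coordinates `k′ ⊗ ℂ ≅ ℂ^d` where the ℚ-points are a ℚ-form) and
N1 §ID-2(c) / T5GenericTriples («the independent triples being Zariski-dense in `Hom³` when
`dim_ℚ Hom ≥ 3`»: the polynomial `detPoly` is non-zero, so it is non-zero at some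
ℚ-rational triple). This file records the polynomial identity behind both:

* `MvPolynomial.eq_zero_of_forall_eval_mem_eq_zero` — over an integral domain `R`, a
  polynomial in `N` variables vanishing at every point with coordinates in an infinite
  subset `S ⊆ R` is zero (induction on `N` through `finSuccEquiv`, one variable at a time
  with `Polynomial.eq_zero_of_infinite_isRoot`);
* `MvPolynomial.eq_zero_of_forall_eval_mem_eq_zero'` — the same for any finite set of
  variables; `MvPolynomial.exists_eval_mem_ne_zero` — contrapositive: a non-zero polynomial
  is non-zero at some `S`-point;
* `exists_rat_eval_ne_zero` — `ℚ^N` is Zariski-dense in `ℂ^N`;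
* `exists_rat_ne_zero_eval_ne_zero` — `(ℚ^×)^N` is Zariski-dense in `ℂ^N` (the torus case
  of B3(d.3), in split coordinates);
* `exists_int_eval_ne_zero` — the same for `ℤ^N`;
* `exists_rat_triple_minor_ne_zero`, `exists_rat_triple_linearIndependent` — the application
  to ID-C1 on top of `T5GenericTriples`: a linearly independent triple with rational
  coordinates in three given basis vectors exists.

Nothing about tori, restriction of scalars or Hom-groups is formalised: `R` is any integral
domain, `S` any infinite subset.
-/

namespace Summit.Ventures.HodgeRepro2.T5RationalDensity

open MvPolynomial

variable {R : Type*} [CommRing R] [IsDomain R]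

/-- **Density of `S^N`.** A polynomial in `N` variables over an integral domain that vanishes at
every point with all coordinates in an infinite subset `S` is the zero polynomial. -/
theorem MvPolynomial.eq_zero_of_forall_eval_mem_eq_zero {S : Set R} (hS : S.Infinite) :
    ∀ {N : ℕ} (f : MvPolynomial (Fin N) R),
      (∀ x : Fin N → R, (∀ i, x i ∈ S) → eval x f = 0) → f = 0 := by
  intro N
  induction N with
  | zero =>
    intro f hf
    have h0 := hf (fun _ => 0) (fun i => Fin.elim0 i)
    -- a polynomial in no variables is its constant term
    have hconst : f = C (coeff 0 f) := by
      apply MvPolynomial.ext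
      intro d
      have hd : d = 0 := Finsupp.ext fun i => Fin.elim0 i
      subst hd
      rw [coeff_C, if_pos rfl]
    rw [hconst, eval_C] at h0
    rw [hconst, h0, C_0]
  | succ N ih =>
    intro f hf
    -- view `f` as a polynomial in `X_0` with coefficients in `N` variables
    set g := finSuccEquiv R N f with hg
    have hcoeff : ∀ i : ℕ, Polynomial.coeff g i = 0 := by
      intro i
      apply ih
      intro s hs
      -- the one-variable polynomial obtained by evaluating the coefficients at `s`
      have hφ : Polynomial.map (eval s) g = 0 := by
        apply Polynomial.eq_zero_of_infinite_isRoot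
        apply hS.mono
        intro y hy
        simp only [Set.mem_setOf_eq, Polynomial.IsRoot.def]
        rw [← eval_eq_eval_mv_eval']
        apply hf
        intro j
        refine Fin.cases ?_ ?_ j
        · simpa using hy
        · intro k; simpa using hs k
      have := congrArg (fun p : Polynomial R => p.coeff i) hφ
      simpa only [coeff_eval_eq_eval_coeff, Polynomial.coeff_zero] using this
    have hg0 : g = 0 := Polynomial.ext fun i => by rw [hcoeff i, Polynomial.coeff_zero]
    exact (finSuccEquiv R N).injective (by rw [← hg, hg0, map_zero])

/-- The same for any finite set of variables (through `rename` along `Fintype.equivFin`). -/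
theorem MvPolynomial.eq_zero_of_forall_eval_mem_eq_zero' {S : Set R} (hS : S.Infinite)
    {σ : Type*} [Fintype σ] (f : MvPolynomial σ R)
    (hf : ∀ x : σ → R, (∀ i, x i ∈ S) → eval x f = 0) : f = 0 := by
  set e := Fintype.equivFin σ
  have hg : rename e f = 0 := by
    apply MvPolynomial.eq_zero_of_forall_eval_mem_eq_zero hS
    intro y hy
    rw [eval_rename]
    exact hf (y ∘ e) fun i => hy (e i)
  exact (rename_injective e e.injective) (by rw [hg, map_zero])

/-- A non-zero polynomial is non-zero at some point with coordinates in an infinite subset. -/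
theorem MvPolynomial.exists_eval_mem_ne_zero {S : Set R} (hS : S.Infinite) {σ : Type*}
    [Fintype σ] {f : MvPolynomial σ R} (hf : f ≠ 0) :
    ∃ x : σ → R, (∀ i, x i ∈ S) ∧ eval x f ≠ 0 := by
  by_contra h
  push Not at h
  exact hf (MvPolynomial.eq_zero_of_forall_eval_mem_eq_zero' hS f h)

/-- The rational numbers form an infinite subset of `ℂ`. -/
theorem infinite_range_ratCast : (Set.range ((↑) : ℚ → ℂ)).Infinite :=
  Set.infinite_range_of_injective Rat.cast_injective

/-- The non-zero rational numbers form an infinite subset of `ℂ`. -/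
theorem infinite_range_ratCast_ne_zero : {z : ℂ | ∃ q : ℚ, q ≠ 0 ∧ (q : ℂ) = z}.Infinite := by
  have : {z : ℂ | ∃ q : ℚ, q ≠ 0 ∧ (q : ℂ) = z} = ((↑) : ℚ → ℂ) '' {q : ℚ | q ≠ 0} := by
    ext z; simp only [Set.mem_setOf_eq, Set.mem_image]
  rw [this]
  refine Set.Infinite.image Rat.cast_injective.injOn ?_
  exact Set.infinite_of_injective_forall_mem (f := fun n : ℕ => (n : ℚ) + 1)
    (fun a b h => by simpa using h) (fun n => by simp only [Set.mem_setOf_eq]; positivity)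

/-- **`ℚ^N` is Zariski-dense in `ℂ^N`.** A non-zero complex polynomial in `N` variables is
non-zero at some rational point. -/
theorem exists_rat_eval_ne_zero {σ : Type*} [Fintype σ] {f : MvPolynomial σ ℂ} (hf : f ≠ 0) :
    ∃ x : σ → ℚ, eval (fun i => (x i : ℂ)) f ≠ 0 := by
  obtain ⟨x, hx, hfx⟩ := MvPolynomial.exists_eval_mem_ne_zero infinite_range_ratCast hf
  choose q hq using hx
  refine ⟨q, ?_⟩
  have : (fun i => (q i : ℂ)) = x := funext hq
  rw [this]
  exact hfx

/-- **`(ℚ^×)^N` is Zariski-dense in `ℂ^N`.** A non-zero complex polynomial in `N` variables is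
non-zero at some rational point with all coordinates non-zero — the ℚ-points of a split torus
(T4-B3 §B3(d.3) in split coordinates). -/
theorem exists_rat_ne_zero_eval_ne_zero {σ : Type*} [Fintype σ] {f : MvPolynomial σ ℂ}
    (hf : f ≠ 0) :
    ∃ x : σ → ℚ, (∀ i, x i ≠ 0) ∧ eval (fun i => (x i : ℂ)) f ≠ 0 := by
  obtain ⟨x, hx, hfx⟩ :=
    MvPolynomial.exists_eval_mem_ne_zero infinite_range_ratCast_ne_zero hf
  choose q hq0 hq using hx
  refine ⟨q, hq0, ?_⟩
  have : (fun i => (q i : ℂ)) = x := funext hq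
  rw [this]
  exact hfx

/-- The integers form an infinite subset of `ℂ`. -/
theorem infinite_range_intCast : (Set.range ((↑) : ℤ → ℂ)).Infinite :=
  Set.infinite_range_of_injective Int.cast_injective

/-- **`ℤ^N` is Zariski-dense in `ℂ^N`.** -/
theorem exists_int_eval_ne_zero {σ : Type*} [Fintype σ] {f : MvPolynomial σ ℂ} (hf : f ≠ 0) :
    ∃ x : σ → ℤ, eval (fun i => (x i : ℂ)) f ≠ 0 := by
  obtain ⟨x, hx, hfx⟩ := MvPolynomial.exists_eval_mem_ne_zero infinite_range_intCast hf
  choose q hq using hx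
  refine ⟨q, ?_⟩
  have : (fun i => (q i : ℂ)) = x := funext hq
  rw [this]
  exact hfx

/-! ## The application to ID-C1: a linearly independent triple with RATIONAL coordinates -/

section Triples

open Summit.Ventures.HodgeRepro2.T5GenericTriples

variable {V : Type*} [AddCommGroup V] [Module ℂ V] {ι : Type*}

/-- The coordinates of a combination of three distinct basis vectors. -/
theorem repr_sum_smul_basis (b : Module.Basis ι ℂ V) {e : Fin 3 → ι} (he : Function.Injective e)
    (c : Fin 3 → ℂ) (i : Fin 3) : b.repr (∑ k, c k • b (e k)) (e i) = c i := by
  classical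
  simp only [map_sum, map_smul, Finsupp.coe_finsetSum, Finsupp.coe_smul, Finset.sum_apply,
    Pi.smul_apply, Module.Basis.repr_self, Finsupp.single_apply, smul_eq_mul]
  rw [Finset.sum_eq_single i]
  · simp
  · intro k _ hk
    simp [he.ne hk]
  · intro h
    exact absurd (Finset.mem_univ i) h

/-- **ID-C1, the rational witness.** For three distinct basis vectors `b (e 0), b (e 1), b (e 2)`
of a complex vector space there is a triple with RATIONAL coordinates in them whose `3 × 3`
minor is non-zero — `detPoly` is non-zero (T5GenericTriples) and `ℚ^9` is Zariski-dense. -/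
theorem exists_rat_triple_minor_ne_zero (b : Module.Basis ι ℂ V) {e : Fin 3 → ι}
    (he : Function.Injective e) :
    ∃ c : Fin 3 × Fin 3 → ℚ, minor b e (fun j => ∑ i, (c (i, j) : ℂ) • b (e i)) ≠ 0 := by
  obtain ⟨x, hx⟩ := exists_rat_eval_ne_zero (detPoly_ne_zero (K := ℂ))
  refine ⟨x, ?_⟩
  rw [minor_eq_eval_detPoly]
  have hcoord : (fun p : Fin 3 × Fin 3 =>
      b.repr (∑ i, (x (i, p.2) : ℂ) • b (e i)) (e p.1)) = fun i => (x i : ℂ) := by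
    funext p
    rw [repr_sum_smul_basis b he (fun i => (x (i, p.2) : ℂ)) p.1]
  rw [hcoord]
  exact hx

/-- Hence a linearly independent triple with rational coordinates exists: «the independent
triples are Zariski-dense in `Hom³` when `dim_ℚ Hom ≥ 3`» (N1 §ID-2(c), ID-C1). -/
theorem exists_rat_triple_linearIndependent (b : Module.Basis ι ℂ V) {e : Fin 3 → ι}
    (he : Function.Injective e) :
    ∃ c : Fin 3 × Fin 3 → ℚ,
      LinearIndependent ℂ (fun j => ∑ i, (c (i, j) : ℂ) • b (e i)) := by
  obtain ⟨c, hc⟩ := exists_rat_triple_minor_ne_zero b he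
  refine ⟨c, ?_⟩
  by_contra h
  exact hc (minor_eq_zero_of_not_linearIndependent b e h)

end Triples

end Summit.Ventures.HodgeRepro2.T5RationalDensity
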